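import Literature.MathematicalPhysics.KineticTheory.DiPernaLionsTestedExpForm
import Literature.MathematicalPhysics.KineticTheory.DiPernaLionsGainLevelTruncation
import Literature.MathematicalPhysics.KineticTheory.DiPernaLionsCollisionTermsProofs
import HarnessLib

/-!
# The level-truncated Duhamel gain term of the approximating sequence: uniform estimates

Topic: MathematicalPhysics / KineticTheory. Infrastructure for the subsolution half of the named
fact (L12) `diPernaLions_limit_expDuhamel` (Cercignani–Illner–Pulvirenti 1994 §5.3 Lemma 5.3.12,
pp. 158–159). With the level truncation of `DiPernaLionsGainLevelTruncation` in place of the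
renormalisation (3.41), the damped Duhamel gain term of (3.36), integrated over a set `S` of
characteristics, splits into the level-truncated term and an exceptional term. This file provides
the uniform-in-`n` control of the exceptional term and the bookkeeping needed to pass to the
limit in the level-truncated term:

* `exists_level_exceptional_le` (**the exceptional term is uniformly small**): for every `η > 0`
  there is a level `M` with `∫_{S ∩ {e^{Λₙ♯(t)} fⁿ♯(t) > M}} fⁿ♯(t) ≤ η` for all `n` along the
  sequence, from the equi-integrability of the (sheared) slices, Markov's inequality
  (`measure_level_gt_le`) and a uniform bound on `∫_{E×B̄_R} Λₙ♯(t)` (the uniform `L¹` bound on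
  the velocity convolutions `Aₙ ∗ fⁿ`, `exists_conv_lintegral_le`, integrated along
  characteristics).
* `lintegral_set_levelCut_dampedGain_eq` (**free-flow coordinates**): the level-truncated term over
  `S` is the phase-space-time integral of `aₙ Q₊ⁿ(fⁿ,fⁿ)` against the weight
  `1_{fⁿ ≤ M} 1_{(0,t]}(s) 1_S(y - sv, v) e^{-(Λₙ♯(t)-Λₙ♯(s))(y - sv, v)}`.
* `levelCut_gain_le_normGain` (**domination by Lemma 5.3.7's family**):
  `1_{fⁿ ≤ M} aₙ Q₊ⁿ(fⁿ,fⁿ) ≤ (1 + M) aₙ Q₊ⁿ(fⁿ,fⁿ)/(1 + fⁿ)` in `[0, ∞]`.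

Everything is proved; theorems only; no named fact is introduced.

## References

* C. Cercignani, R. Illner, M. Pulvirenti, *The Mathematical Theory of Dilute Gases*, Springer
  (1994), §5.3 Lemma 5.3.7 (p. 148), Step 13 (3.36) (p. 157), proof of Lemma 5.3.12
  (pp. 158–159).
-/

open MeasureTheory Metric Real Set Filter Topology
open scoped InnerProductSpace ENNReal NNReal

noncomputable section

namespace Literature.MathematicalPhysics.KineticTheory

open Literature.Analysis.FluidPDE Literature.Analysis.FunctionSpaces DiPernaLionsMildLimitProofs

/-! ## Equi-integrability through a measure-preserving change of variables -/

section Generic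

variable {α β : Type*} [MeasurableSpace α] [MeasurableSpace β] {μ : Measure α} {ν : Measure β}

/-- Equi-integrability (bundled with measurability and the uniform bound) is transported by a
measure-preserving measurable equivalence. [folklore] -/
theorem uniformIntegrable_comp_measurePreserving {ι : Type*} {f : ι → α → ℝ} {p : ℝ≥0∞}
    (hf : UniformIntegrable f p μ) (e : β ≃ᵐ α) (he : MeasurePreserving e ν μ) :
    UniformIntegrable (fun i x => f i (e x)) p ν := by
  obtain ⟨hmeas, hui, C, hC⟩ := hf
  have hcomp : ∀ (i : ι) (g : α → ℝ), AEStronglyMeasurable g μ →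
      eLpNorm (fun x => g (e x)) p ν = eLpNorm g p μ := fun i g hg =>
    eLpNorm_comp_measurePreserving hg he
  refine ⟨fun i => (hmeas i).comp_measurePreserving he, fun ε hε => ?_, C, fun i => ?_⟩
  · obtain ⟨δ, hδ, h⟩ := hui hε
    refine ⟨δ, hδ, fun i s hs hνs => ?_⟩
    have hs' : MeasurableSet (e.symm ⁻¹' s) := e.symm.measurable hs
    have hmeas_s : μ (e.symm ⁻¹' s) = ν s := by
      rw [← he.measure_preimage hs'.nullMeasurableSet]
      congr 1
      ext x; simp
    have key := h i (e.symm ⁻¹' s) hs' (hmeas_s ▸ hνs)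
    have hind : (s.indicator fun x => f i (e x)) = fun x => ((e.symm ⁻¹' s).indicator (f i)) (e x) := by
      ext x
      simp only [indicator]
      by_cases hx : x ∈ s
      · have : e x ∈ e.symm ⁻¹' s := by simpa using hx
        rw [if_pos hx, if_pos this]
      · have : e x ∉ e.symm ⁻¹' s := by simpa using hx
        rw [if_neg hx, if_neg this]
    rw [hind, hcomp i _ ((hmeas i).indicator hs')]
    exact key
  · rw [hcomp i _ (hmeas i)]
    exact hC i

end Generic

section Sequence

universe u

variable {E : Type u} [NormedAddCommGroup E] [InnerProductSpace ℝ E] [FiniteDimensional ℝ E]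
  [MeasurableSpace E] [BorelSpace E]

variable {B : E × E → sphere (0 : E) 1 → ℝ} {f₀ : E → E → ℝ} {δ : ℕ → ℝ}
  {Bseq : ℕ → E × E → sphere (0 : E) 1 → ℝ} {fseq : ℕ → ℝ → E → E → ℝ}

/-! ## A uniform bound on the damping exponents in `L¹(E × B̄_R)` -/

/-- **Pointwise bound of the truncated collision frequency by the true velocity convolution**:
`λ_δ(f)(t,x,v) ≤ ∫ Aₙ(v - w) f(t,x,w) dw` in `[0,∞]` (`(1 + δ∫f)⁻¹ ≤ 1`, Galilean invariance,
`ofReal ∫ ≤ ∫⁻ ofReal`). [folklore] -/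
theorem ofReal_truncatedCollisionFrequency_le {δ' : ℝ} {B' : E × E → sphere (0 : E) 1 → ℝ}
    {g : ℝ → E → E → ℝ} (hg : IsDiPernaLionsApproximateSolution δ' B' g)
    (hB'k : IsDiPernaLionsKernel B') (hδ' : 0 ≤ δ') (t : ℝ) (ht : 0 ≤ t) (x v : E) :
    ENNReal.ofReal (truncatedCollisionFrequency δ' B' g t x v) ≤
      ∫⁻ w, ENNReal.ofReal (kernelAngularIntegral B' (v - w) * g t x w) := by
  have h1 : truncatedCollisionFrequency δ' B' g t x v ≤ DiPernaLionsMildLimit.collisionFrequency B' g t x v :=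
    truncatedCollisionFrequency_le hB'k.nonneg hδ' (fun w => hg.nonneg t ht _ _) v
  have h2 : DiPernaLionsMildLimit.collisionFrequency B' g t x v =
      ∫ w, kernelAngularIntegral B' (v - w) * g t x w := by
    unfold DiPernaLionsMildLimit.collisionFrequency
    refine integral_congr_ae (ae_of_all _ fun w => ?_)
    dsimp only
    rw [integral_mul_const, integral_kernel_eq_kernelAngularIntegral hB'k.sub_right]
  calc ENNReal.ofReal (truncatedCollisionFrequency δ' B' g t x v)
      ≤ ENNReal.ofReal (∫ w, kernelAngularIntegral B' (v - w) * g t x w) := by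
        rw [← h2]; exact ENNReal.ofReal_le_ofReal h1
    _ ≤ ∫⁻ w, ENNReal.ofReal (kernelAngularIntegral B' (v - w) * g t x w) := ofReal_integral_le_lintegral _

/-- **The damping exponents are uniformly bounded in `L¹(E × B̄_R)`** (CIP 1994 §5.3 Step 13 with
(3.12): `∫_{E×B̄_R} Λₙ♯(t) ≤ ∫_{(0,T)×E×B̄_R} λₙ ≤ ∫_{(0,T)×E×B̄_R} Aₙ ∗ fⁿ ≤ C` uniformly in `n`,
by the uniform bound on the velocity convolutions of Lemma 5.3.7 (ii a)). [cite: CIPDiluteGases1994, §5.3 Lemma 5.3.7 (ii a) (p. 148) and Step 13 (p. 157)] -/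
theorem exists_lintegral_truncatedDampingExponent_le (hB : IsDiPernaLionsKernel B)
    (hker : IsDiPernaLionsKernelApproximation B Bseq) (hδ : ∀ n, 0 < δ n)
    (hsol : ∀ n, IsDiPernaLionsApproximateSolution (δ n) (Bseq n) (fseq n))
    (hbd : UniformDiPernaLionsBounds δ Bseq fseq) {T : ℝ} (hT : 0 < T) (R : ℝ) :
    ∃ CΛ : ℝ≥0, ∀ n, ∀ t ∈ Icc 0 T, ∫⁻ z in univ ×ˢ closedBall (0 : E) R,
      ENNReal.ofReal (truncatedDampingExponent (δ n) (Bseq n) (fseq n) t z.1 z.2)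
        ∂((volume : Measure E).prod volume) ≤ CΛ := by
  obtain ⟨CL, hCL⟩ := exists_conv_lintegral_le hB hker hsol hbd hT R
  refine ⟨CL, fun n t ht => ?_⟩
  have hBn := hker.isDiPernaLionsKernel n
  obtain ⟨Cb, hCb⟩ := hker.bounded n
  obtain ⟨hFm, hF0⟩ := (hsol n).measurable_clamp_uncurry
  -- the integrand on the box
  set Ψ : ℝ × E × E → ℝ≥0∞ := fun q => ∫⁻ w, ENNReal.ofReal (kernelAngularIntegral (Bseq n) (q.2.2 - w) *
    fseq n (max q.1 0) q.2.1 w) with hΨ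
  have hΨm : Measurable Ψ := by
    have hAm := measurable_kernelAngularIntegral hBn.measurable
    have h : Measurable fun p : (ℝ × E × E) × E =>
        ENNReal.ofReal (kernelAngularIntegral (Bseq n) (p.1.2.2 - p.2) * fseq n (max p.1.1 0) p.1.2.1 p.2) :=
      ((hAm.comp (measurable_fst.snd.snd.sub measurable_snd)).mul
        (hFm.comp (measurable_fst.fst.prodMk (measurable_fst.snd.fst.prodMk measurable_snd)))).ennreal_ofReal
    exact h.lintegral_prod_right'
  -- pointwise: `Λ♯(t,z) ≤ ∫_{(0,T]} Ψ♯`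
  have hpt : ∀ z : E × E, ENNReal.ofReal (truncatedDampingExponent (δ n) (Bseq n) (fseq n) t z.1 z.2) ≤
      ∫⁻ s in Ioc 0 T, Ψ (s, z.1 + s • z.2, z.2) := by
    intro z
    rw [truncatedDampingExponent_apply]
    have hcont := (hsol n).continuousOn_truncatedCollisionFrequency_sharp hBn.measurable hBn.nonneg hCb
      (hδ n).le z.1 z.2 hT.le
    have hint : IntegrableOn (fun s => truncatedCollisionFrequency (δ n) (Bseq n) (fseq n) s (z.1 + s • z.2) z.2)
        (Ioc 0 T) := hcont.integrableOn_Icc.mono_set Ioc_subset_Icc_self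
    have hnn : ∀ s ∈ Ioc 0 T, 0 ≤ truncatedCollisionFrequency (δ n) (Bseq n) (fseq n) s (z.1 + s • z.2) z.2 :=
      fun s hs => truncatedCollisionFrequency_nonneg hBn.nonneg (hδ n).le
        (fun w => (hsol n).nonneg s hs.1.le _ _) _
    calc ENNReal.ofReal (∫ s in Ioc 0 t, truncatedCollisionFrequency (δ n) (Bseq n) (fseq n) s (z.1 + s • z.2) z.2)
        ≤ ENNReal.ofReal (∫ s in Ioc 0 T, truncatedCollisionFrequency (δ n) (Bseq n) (fseq n) s (z.1 + s • z.2) z.2) :=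
          ENNReal.ofReal_le_ofReal (setIntegral_mono_set hint
            ((ae_restrict_iff' measurableSet_Ioc).2 (ae_of_all _ hnn))
            (ae_of_all _ (Ioc_subset_Ioc_right ht.2)))
      _ ≤ ∫⁻ s in Ioc 0 T, ENNReal.ofReal (truncatedCollisionFrequency (δ n) (Bseq n) (fseq n) s (z.1 + s • z.2) z.2) :=
          ofReal_integral_le_lintegral _
      _ ≤ ∫⁻ s in Ioc 0 T, Ψ (s, z.1 + s • z.2, z.2) := by
          refine setLIntegral_mono' measurableSet_Ioc fun s hs => ?_
          have h := ofReal_truncatedCollisionFrequency_le (hsol n) hBn (hδ n).le s hs.1.le (z.1 + s • z.2) z.2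
          simp only [hΨ, max_eq_left hs.1.le]
          exact h
  calc ∫⁻ z in univ ×ˢ closedBall (0 : E) R,
        ENNReal.ofReal (truncatedDampingExponent (δ n) (Bseq n) (fseq n) t z.1 z.2) ∂((volume : Measure E).prod volume)
      ≤ ∫⁻ q in Ioc 0 T ×ˢ ((univ : Set E) ×ˢ closedBall (0 : E) R), Ψ q :=
        lintegral_phase_ball_le_box hΨm (ae_of_all _ hpt)
    _ = ∫⁻ q in Ioo 0 T ×ˢ ((univ : Set E) ×ˢ closedBall (0 : E) R), Ψ q := by
        have hμeq : (volume : Measure (ℝ × E × E)).restrict (Ioc 0 T ×ˢ ((univ : Set E) ×ˢ closedBall (0 : E) R)) =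
            (volume : Measure (ℝ × E × E)).restrict (Ioo 0 T ×ˢ ((univ : Set E) ×ˢ closedBall (0 : E) R)) := by
          calc (volume : Measure (ℝ × E × E)).restrict (Ioc 0 T ×ˢ ((univ : Set E) ×ˢ closedBall (0 : E) R))
              = ((volume : Measure ℝ).restrict (Ioc 0 T)).prod
                  (((volume : Measure E).prod volume).restrict ((univ : Set E) ×ˢ closedBall (0 : E) R)) :=
                (Measure.prod_restrict _ _).symm
            _ = ((volume : Measure ℝ).restrict (Ioo 0 T)).prod
                  (((volume : Measure E).prod volume).restrict ((univ : Set E) ×ˢ closedBall (0 : E) R)) := by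
                rw [restrict_Ioo_eq_restrict_Ioc]
            _ = _ := Measure.prod_restrict _ _
        rw [hμeq]
    _ ≤ CL := hCL n

/-! ## The exceptional term of the level truncation is uniformly small -/

/-- **Uniform smallness of the exceptional term** (the tree's replacement for the
`m → ∞` step of CIP 1994 §5.3, proof of Lemma 5.3.12, pp. 158–159): along a subsequence `φ`, for
`t ∈ [0,T]`, `R` and every `η > 0` there is a level `M > 0` such that
`∫_{(E×B̄_R) ∩ {e^{Λₖ♯(t)} f^{φ(k)}♯(t) > M}} f^{φ(k)}♯(t) ≤ η` for all `k`: the sheared slices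
`f^{φ(k)}♯(t)` are equi-integrable (Lemma 5.3.7's Dunford–Pettis bounds and the invariance of
Lebesgue measure under the shear), and the exceptional sets are uniformly small by Markov's
inequality, the uniform `L¹(E×B̄_R)` bound on `Λₖ♯(t)` and the mass bound. [cite: CIPDiluteGases1994, §5.3 proof of Lemma 5.3.12 (pp. 158–159)] -/
theorem exists_level_exceptional_le (hB : IsDiPernaLionsKernel B)
    (hker : IsDiPernaLionsKernelApproximation B Bseq) (hδ : ∀ n, 0 < δ n)
    (hsol : ∀ n, IsDiPernaLionsApproximateSolution (δ n) (Bseq n) (fseq n))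
    (hbd : UniformDiPernaLionsBounds δ Bseq fseq) (φ : ℕ → ℕ) {T t : ℝ} (hT : 0 < T) (ht : t ∈ Icc 0 T)
    (R : ℝ) {η : ℝ} (hη : 0 < η) :
    ∃ M : ℝ, 0 < M ∧ ∀ k, ∫⁻ z in (univ ×ˢ closedBall (0 : E) R) ∩
        {z | M < exp (truncatedDampingExponent (δ (φ k)) (Bseq (φ k)) (fseq (φ k)) t z.1 z.2) *
          fseq (φ k) t (z.1 + t • z.2) z.2},
        ENNReal.ofReal (fseq (φ k) t (z.1 + t • z.2) z.2) ∂((volume : Measure E).prod volume) ≤ ENNReal.ofReal η := by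
  set μ : Measure (E × E) := (volume : Measure E).prod volume with hμ
  -- equi-integrability of the sheared slices
  obtain ⟨hUI, -⟩ := uniformIntegrable_unifTight_slice hsol hbd φ ht.1
  have hUIs : UniformIntegrable (fun k (z : E × E) => fseq (φ k) t (z.1 + t • z.2) z.2) 1 μ := by
    have h := uniformIntegrable_comp_measurePreserving hUI (freeShearEquiv (E := E) t)
      (measurePreserving_freeShearEquiv t)
    simpa only [freeShearEquiv_apply] using h
  obtain ⟨δ₀, hδ₀, hδ₀spec⟩ := hUIs.2.1 hη
  -- the uniform bounds: damping exponents and mass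
  obtain ⟨CΛ, hCΛ⟩ := exists_lintegral_truncatedDampingExponent_le hB hker hδ hsol hbd hT R
  obtain ⟨Cm, hCm⟩ := hbd.massEntropy_le T hT.le
  have hmass : ∀ k, ∫⁻ z, ENNReal.ofReal (fseq (φ k) t (z.1 + t • z.2) z.2) ∂μ ≤ ENNReal.ofReal (max Cm 0) := by
    intro k
    have key := (measurePreserving_freeShear (E := E) t).lintegral_comp
      (f := fun z : E × E => ENNReal.ofReal (fseq (φ k) t z.1 z.2))
      (((hsol (φ k)).contDiff_slice t ht.1).continuous.measurable.ennreal_ofReal)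
    rw [show (∫⁻ z, ENNReal.ofReal (fseq (φ k) t (z.1 + t • z.2) z.2) ∂μ) =
      ∫⁻ z : E × E, ENNReal.ofReal (fseq (φ k) t z.1 z.2) ∂μ from key]
    refine le_trans (lintegral_mono fun z => ENNReal.ofReal_le_ofReal ?_)
      ((hCm (φ k) t ht).trans (ENNReal.ofReal_le_ofReal (le_max_left _ _)))
    refine le_mul_of_one_le_right ((hsol (φ k)).nonneg t ht.1 _ _) ?_
    nlinarith [sq_nonneg ‖z.1‖, sq_nonneg ‖z.2‖, abs_nonneg (log (fseq (φ k) t z.1 z.2))]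
  -- choice of `L₀` and `M`: `CΛ / L₀ ≤ δ₀/2`, `max Cm 0 / (M e^{-L₀}) ≤ δ₀/2`
  set L₀ : ℝ := 2 * (CΛ + 1) / δ₀ with hL₀
  have hL₀pos : 0 < L₀ := by positivity
  set M : ℝ := 2 * (max Cm 0 + 1) * exp L₀ / δ₀ with hM
  have hMpos : 0 < M := by positivity
  refine ⟨M, hMpos, fun k => ?_⟩
  set SR : Set (E × E) := univ ×ˢ closedBall (0 : E) R with hSR
  have hSRm : MeasurableSet SR := MeasurableSet.univ.prod measurableSet_closedBall
  set Λk : E × E → ℝ := fun z => truncatedDampingExponent (δ (φ k)) (Bseq (φ k)) (fseq (φ k)) t z.1 z.2 with hΛk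
  set Fk : E × E → ℝ := fun z => fseq (φ k) t (z.1 + t • z.2) z.2 with hFk
  have hΛkm : Measurable Λk :=
    ((hsol (φ k)).measurable_truncatedDampingExponent (hker.isDiPernaLionsKernel (φ k)).measurable).comp
      (measurable_const.prodMk measurable_id)
  have hFkc : Continuous Fk := by
    have h1 : Continuous fun z : E × E => ((t, z.1 + t • z.2, z.2) : ℝ × E × E) := by fun_prop
    exact (hsol (φ k)).contDiffOn.continuousOn.comp_continuous h1 fun z => ⟨mem_Ici.2 ht.1, mem_univ _⟩
  have hFkm : Measurable Fk := hFkc.measurable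
  have hFk0 : ∀ z, 0 ≤ Fk z := fun z => (hsol (φ k)).nonneg t ht.1 _ _
  -- the measure of the exceptional set
  have hset_m : MeasurableSet (SR ∩ {z | M < exp (Λk z) * Fk z}) :=
    hSRm.inter (measurableSet_lt measurable_const (hΛkm.exp.mul hFkm))
  have hsmall : μ (SR ∩ {z | M < exp (Λk z) * Fk z}) ≤ ENNReal.ofReal δ₀ := by
    have h := measure_level_gt_le hΛkm hFkm hFk0 hSRm hL₀pos hMpos
    refine h.trans ?_
    have h1 : (∫⁻ z in SR, ENNReal.ofReal (Λk z) ∂μ) / ENNReal.ofReal L₀ ≤ ENNReal.ofReal (δ₀ / 2) := by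
      rw [ENNReal.div_le_iff (by simpa using hL₀pos) ENNReal.ofReal_ne_top]
      calc ∫⁻ z in SR, ENNReal.ofReal (Λk z) ∂μ ≤ (CΛ : ℝ≥0∞) := hCΛ (φ k) t ht
        _ = ENNReal.ofReal (CΛ : ℝ) := (ENNReal.ofReal_coe_nnreal).symm
        _ ≤ ENNReal.ofReal (δ₀ / 2 * L₀) := ENNReal.ofReal_le_ofReal (by
            rw [hL₀]; field_simp; nlinarith [NNReal.coe_nonneg CΛ])
        _ = ENNReal.ofReal (δ₀ / 2) * ENNReal.ofReal L₀ := by rw [ENNReal.ofReal_mul (by positivity)]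
    have h2 : (∫⁻ z in SR, ENNReal.ofReal (Fk z) ∂μ) / ENNReal.ofReal (M * exp (-L₀)) ≤ ENNReal.ofReal (δ₀ / 2) := by
      have hpos : 0 < M * exp (-L₀) := mul_pos hMpos (exp_pos _)
      rw [ENNReal.div_le_iff (by simpa using hpos) ENNReal.ofReal_ne_top]
      calc ∫⁻ z in SR, ENNReal.ofReal (Fk z) ∂μ ≤ ∫⁻ z, ENNReal.ofReal (Fk z) ∂μ :=
            lintegral_mono' Measure.restrict_le_self le_rfl
        _ ≤ ENNReal.ofReal (max Cm 0) := hmass k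
        _ ≤ ENNReal.ofReal (δ₀ / 2 * (M * exp (-L₀))) := ENNReal.ofReal_le_ofReal (by
            have hM' : M * exp (-L₀) = 2 * (max Cm 0 + 1) / δ₀ := by
              rw [hM, div_mul_eq_mul_div, mul_assoc, ← Real.exp_add, add_neg_cancel, Real.exp_zero, mul_one]
            rw [hM']; field_simp; nlinarith [le_max_right Cm 0])
        _ = ENNReal.ofReal (δ₀ / 2) * ENNReal.ofReal (M * exp (-L₀)) := by
            rw [ENNReal.ofReal_mul (by positivity)]
    calc _ ≤ ENNReal.ofReal (δ₀ / 2) + ENNReal.ofReal (δ₀ / 2) := add_le_add h1 h2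
      _ = ENNReal.ofReal δ₀ := by rw [← ENNReal.ofReal_add (by positivity) (by positivity), add_halves]
  -- equi-integrability on the exceptional set
  have key := hδ₀spec k _ hset_m hsmall
  rw [eLpNorm_one_eq_lintegral_enorm] at key
  refine le_trans (le_of_eq ?_) key
  rw [← lintegral_indicator hset_m]
  refine lintegral_congr fun z => ?_
  simp only [enorm_indicator_eq_indicator_enorm]
  by_cases hz : z ∈ SR ∩ {z | M < exp (Λk z) * Fk z}
  · rw [indicator_of_mem hz, indicator_of_mem hz, Real.enorm_eq_ofReal (hFk0 z)]
  · rw [indicator_of_notMem hz, indicator_of_notMem hz]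

/-! ## The level-truncated term in free-flow coordinates, and its domination -/

/-- **The level-truncated damped gain term over a set of characteristics, in free-flow
coordinates** (for one approximate solution `g` with parameter `δ'` and kernel `B'`): the integral
over `S` of `∫₀ᵗ 1_{g♯(s) ≤ M} a♯ Q₊(g,g)♯ e^{-(Λ♯(t)-Λ♯(s))} ds` equals the phase-space-time
integral of `a Q₊(g,g)` against the weight
`1_{g(s∨0) ≤ M} · 1_{(0,t]}(s) 1_S(y - sv, v) e^{-(Λ♯(t) - Λ♯(s))(y - sv, v)}` (the time clamp is
inactive on `(0,t]`; it makes the weight measurable). [cite: CIPDiluteGases1994, §5.3 Step 13 (3.36) (p. 157)] -/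
theorem IsDiPernaLionsApproximateSolution.lintegral_set_levelCut_dampedGain_eq {δ' : ℝ}
    {B' : E × E → sphere (0 : E) 1 → ℝ} {g : ℝ → E → E → ℝ}
    (hg : IsDiPernaLionsApproximateSolution δ' B' g) (hB'm : Measurable (Function.uncurry B'))
    (t M : ℝ) {S : Set (E × E)} (hS : MeasurableSet S) :
    ∫⁻ z in S, (∫⁻ s in Ioc 0 t, (Iic M).indicator (fun _ => (1 : ℝ≥0∞)) (g s (z.1 + s • z.2) z.2) *
        (ENNReal.ofReal ((1 + δ' * ∫ w, |g s (z.1 + s • z.2) w|)⁻¹) *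
          eGain B' g (s, z.1 + s • z.2, z.2) *
          ENNReal.ofReal (exp (-(truncatedDampingExponent δ' B' g t z.1 z.2 -
            truncatedDampingExponent δ' B' g s z.1 z.2))))) ∂((volume : Measure E).prod volume) =
      ∫⁻ q : ℝ × E × E, ENNReal.ofReal ((Iic M).indicator (fun _ => (1 : ℝ)) (g (max q.1 0) q.2.1 q.2.2) *
          ((Ioc 0 t).indicator (fun _ => (1 : ℝ)) q.1 *
            S.indicator (fun _ => (1 : ℝ)) (q.2.1 - q.1 • q.2.2, q.2.2) *
            exp (-(truncatedDampingExponent δ' B' g t (q.2.1 - q.1 • q.2.2) q.2.2 -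
              truncatedDampingExponent δ' B' g q.1 (q.2.1 - q.1 • q.2.2) q.2.2)))) *
        (ENNReal.ofReal ((1 + δ' * ∫ w, |g q.1 q.2.1 w|)⁻¹) * eGain B' g q) := by
  obtain ⟨hFm, hF0⟩ := hg.measurable_clamp_uncurry
  -- the measurable (clamped) integrands
  set G : ℝ × E × E → ℝ≥0∞ := fun q => (Iic M).indicator (fun _ => (1 : ℝ≥0∞)) (g (max q.1 0) q.2.1 q.2.2) *
    eGain B' (fun s x v => g (max s 0) x v) q with hGdef
  have hGm : Measurable G :=
    ((measurable_const.indicator measurableSet_Iic).comp hFm).mul (measurable_eGain hB'm hFm)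
  set D : ℝ × (E × E) → ℝ≥0∞ := fun p =>
    ENNReal.ofReal ((1 + δ' * ∫ w, |g (max p.1 0) (p.2.1 + p.1 • p.2.2) w|)⁻¹) *
    ENNReal.ofReal (exp (-(truncatedDampingExponent δ' B' g t p.2.1 p.2.2 -
      truncatedDampingExponent δ' B' g p.1 p.2.1 p.2.2))) with hDdef
  have hDm : Measurable D := hg.measurable_dampingWeight hB'm t
  -- left-hand side: replace the integrand on `(0,t]` by the clamped one
  have hL : ∀ z : E × E, (∫⁻ s in Ioc 0 t, (Iic M).indicator (fun _ => (1 : ℝ≥0∞)) (g s (z.1 + s • z.2) z.2) *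
        (ENNReal.ofReal ((1 + δ' * ∫ w, |g s (z.1 + s • z.2) w|)⁻¹) *
          eGain B' g (s, z.1 + s • z.2, z.2) *
          ENNReal.ofReal (exp (-(truncatedDampingExponent δ' B' g t z.1 z.2 -
            truncatedDampingExponent δ' B' g s z.1 z.2))))) =
      ∫⁻ s in Ioc 0 t, D (s, z) * G (s, z.1 + s • z.2, z.2) := by
    intro z
    refine setLIntegral_congr_fun measurableSet_Ioc fun s hs => ?_
    have hs0 : max s 0 = s := max_eq_left hs.1.le
    have hclamp : eGain B' (fun s x v => g (max s 0) x v) (s, z.1 + s • z.2, z.2) = eGain B' g (s, z.1 + s • z.2, z.2) := by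
      simp only [eGain, hs0]
    simp only [hGdef, hDdef, hs0, hclamp]
    ring
  simp_rw [hL]
  rw [lintegral_set_damped_sharp_eq hGm hDm hS t]
  -- identify the integrands
  refine lintegral_congr fun q => ?_
  by_cases hq : q.1 ∈ Ioc 0 t
  · have hq0 : max q.1 0 = q.1 := max_eq_left hq.1.le
    have hclamp : eGain B' (fun s x v => g (max s 0) x v) q = eGain B' g q := by
      simp only [eGain, hq0]
    simp only [hGdef, hDdef, hq0, hclamp, indicator_of_mem hq]
    by_cases hzS : (q.2.1 - q.1 • q.2.2, q.2.2) ∈ S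
    · simp only [indicator_of_mem hzS]
      by_cases hM : g q.1 q.2.1 q.2.2 ∈ Iic M
      · simp only [indicator_of_mem hM, one_mul, mul_one, sub_add_cancel]
        ring
      · simp only [indicator_of_notMem hM, zero_mul, ENNReal.ofReal_zero, mul_zero]
    · simp only [indicator_of_notMem hzS, zero_mul, mul_zero, ENNReal.ofReal_zero]
  · simp only [indicator_of_notMem hq, zero_mul, mul_zero, ENNReal.ofReal_zero]


/-- **Domination of the level-truncated gain term by the renormalised gain terms of Lemma 5.3.7**:
for an approximate solution `g` (bounded DiPerna–Lions kernel vanishing for large relative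
velocities, `δ' ≥ 0`), on `s ≥ 0`,
`1_{g ≤ M} a Q₊(g,g) ≤ (1 + M) · a Q₊(g,g)/(1 + g)` in `[0, ∞]` (`1_{g ≤ M} ≤ (1+M)/(1+g)`;
the gain integral of an approximate solution is finite, `gainWith_eq_toReal_eGain_slice`). [cite: CIPDiluteGases1994, §5.3 Lemma 5.3.7 (p. 148)] -/
theorem IsDiPernaLionsApproximateSolution.levelCut_gain_le_normGain {δ' : ℝ}
    {B' : E × E → sphere (0 : E) 1 → ℝ} {g : ℝ → E → E → ℝ}
    (hg : IsDiPernaLionsApproximateSolution δ' B' g) (hB'k : IsDiPernaLionsKernel B') {Cb : ℝ}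
    (hCb : ∀ p ω, B' p ω ≤ Cb) {Rb : ℝ} (hRb : ∀ (z : E) ω, Rb ≤ ‖z‖ → B' (z, 0) ω = 0)
    (hδ' : 0 ≤ δ') {M : ℝ} (hM : 0 ≤ M) (q : ℝ × E × E) (hq : 0 ≤ q.1) :
    ENNReal.ofReal ((Iic M).indicator (fun _ => (1 : ℝ)) (g q.1 q.2.1 q.2.2)) *
        (ENNReal.ofReal ((1 + δ' * ∫ w, |g q.1 q.2.1 w|)⁻¹) * eGain B' g q) ≤
      ENNReal.ofReal ((1 + M) * ((1 + δ' * ∫ w, |g q.1 q.2.1 w|)⁻¹ *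
        gainWith B' (g q.1 q.2.1) (g q.1 q.2.1) q.2.2 / (1 + g q.1 q.2.1 q.2.2))) := by
  obtain ⟨hfin, hgain⟩ := hg.gainWith_eq_toReal_eGain_slice hB'k hCb hRb hq q.2.1 q.2.2
  set a : ℝ := (1 + δ' * ∫ w, |g q.1 q.2.1 w|)⁻¹ with ha
  have ha0 : 0 ≤ a := inv_nonneg.2 (by
    have : 0 ≤ δ' * ∫ w, |g q.1 q.2.1 w| := mul_nonneg hδ' (integral_nonneg fun _ => abs_nonneg _)
    linarith)
  have hg0 : 0 ≤ g q.1 q.2.1 q.2.2 := hg.nonneg q.1 hq _ _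
  have hG0 : 0 ≤ gainWith B' (g q.1 q.2.1) (g q.1 q.2.1) q.2.2 := by
    rw [hgain]; exact ENNReal.toReal_nonneg
  -- rewrite `eGain` as `ofReal gainWith`
  have heq : eGain B' g q = ENNReal.ofReal (gainWith B' (g q.1 q.2.1) (g q.1 q.2.1) q.2.2) := by
    rw [hgain, ENNReal.ofReal_toReal hfin.ne]
  rw [heq, ← ENNReal.ofReal_mul ha0, ← ENNReal.ofReal_mul (indicator_nonneg (fun _ _ => zero_le_one) _)]
  refine ENNReal.ofReal_le_ofReal ?_
  by_cases h : g q.1 q.2.1 q.2.2 ≤ M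
  · rw [indicator_of_mem (show g q.1 q.2.1 q.2.2 ∈ Iic M from h), one_mul]
    have hpos : 0 < 1 + g q.1 q.2.1 q.2.2 := by linarith
    rw [mul_div_assoc', le_div_iff₀ hpos]
    calc a * gainWith B' (g q.1 q.2.1) (g q.1 q.2.1) q.2.2 * (1 + g q.1 q.2.1 q.2.2)
        ≤ a * gainWith B' (g q.1 q.2.1) (g q.1 q.2.1) q.2.2 * (1 + M) := by
          gcongr
      _ = (1 + M) * (a * gainWith B' (g q.1 q.2.1) (g q.1 q.2.1) q.2.2) := by ring
  · rw [indicator_of_notMem (show g q.1 q.2.1 q.2.2 ∉ Iic M from h), zero_mul]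
    exact mul_nonneg (by linarith) (div_nonneg (mul_nonneg ha0 hG0) (by linarith))


end Sequence

end Literature.MathematicalPhysics.KineticTheory
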